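/-
Copyright (c) 2026. All rights reserved.
Released under Apache 2.0 license as described in the file LICENSE.
Authors: abc-iut cell, prover seat abc-iut-f-101 (gen 5; row «SB′-D2», abc-iut-L4-lead m136), over abc-iut-L4-t5's
`DiagramComap.lean` (families pulled back along a morphism of oriented graphs) and after abc-iut-w5-d053's
`LogFrobeniusObservablesTSOfPlus.lean` (the same bookkeeping for one particular inclusion).
-/
import Literature.AnabelianGeometry.AbsoluteAnabelian.DiagramChainFamilies
import Literature.AnabelianGeometry.AbsoluteAnabelian.DiagramTelecoreFamilies
import Literature.AnabelianGeometry.AbsoluteAnabelian.DiagramComap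

/-!
# Embeddings of oriented graphs and families of homotopies pushed along them ([AbsTopIII] §0, Def. 3.5 (i)–(iii), toolkit)

S. Mochizuki, *Topics in Absolute Anabelian Geometry III*, §0 p. 26 (oriented graphs, paths, co-verticial pairs), Def. 3.5
(i)–(iii) pp. 74–75 (diagrams of categories, families of homotopies, observables — a family on a SUB-diagram is tacitly a
family on the big diagram supported on the sub-diagram's paths), kurims manuscript `paper:url-5493eb38cbb7`, bib key
`MochizukiAbsTopIII2015`.

Print moves freely between a family of homotopies on a sub-diagram `𝒟' ⊆ 𝒟` (an observable `S_log⊞_v` on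
`D•_{≤2} ∪ {𝒩⊞_v}`) and "the same" family on `𝒟` (inside the telecore diagram `D_{An⊢}`, Cor 5.10 (iv)(b)).  abc-iut-L4-t5's
`DiagramComap.lean` handles the direction big → small (`comap`).  This file handles small → big for the inclusion
`F : Γ⃗' ↪ Γ⃗` of a sub-graph that is

* an **embedding** (`GraphEmbedding F`: injective on vertices and on arrows) — then `F` is injective on paths
  (`GraphEmbedding.mapPath_injective`, `eq_of_mapPath_heq`), and
* a **sieve** (`IsSieve F`: every arrow of `Γ⃗` INTO a vertex of `Γ⃗'` is an arrow of `Γ⃗'`) — then every path of `Γ⃗` into a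
  vertex of `Γ⃗'` is the image of a unique path of `Γ⃗'` (`IsSieve.exists_mapPath`);

and for a family `K` on `F^*𝒟` (e.g. an observable with observation vertex `ω`): the member pairs of `K` into `ω`, read in
`𝒟` (`LiftPair`: a pair of paths of `𝒟` into `F ω` lifting to a boundary pair of `K`), carry well-defined homotopies
(`LiftPair.hom`, `LiftPair.subsingleton'`) forming a SINK PRE-FAMILY at `F ω` in the sense of `DiagramSinkSystems.lean` (sibling file):
identity on the diagonal (`liftη_self`), composition (`lift_trans`), pre-whiskering by arbitrary paths of `𝒟`
(`lift_precomp`, using the sieve property) — and the original boundary pairs are members with their own homotopies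
(`LiftPair.ofMem`, `LiftPair.hom_ofMem`).  Pure bookkeeping; every declaration cites the item of §0 / Def. 3.5 it
transcribes.  Nothing here bears on [IUTchIII] Cor. 3.12.
-/

set_option autoImplicit false

namespace Literature.AnabelianGeometry.AbsoluteAnabelian

open _root_.CategoryTheory _root_.Quiver

universe v u w w'

namespace DiagramOfCategories

variable {V' : Type w'} [Quiver.{v} V'] {V : Type w} [Quiver.{v} V] (F : V' ⥤q V)

/-! ## Embeddings and sieves of oriented graphs -/

/-- A morphism of oriented graphs that is INJECTIVE on vertices and on arrows (the inclusion of a sub-graph, §0).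
[cite: MochizukiAbsTopIII2015, Section 0 p.26] -/
structure GraphEmbedding (F : V' ⥤q V) : Prop where
  obj_injective : Function.Injective F.obj
  map_injective : ∀ {a b : V'}, Function.Injective (F.map : (a ⟶ b) → (F.obj a ⟶ F.obj b))

/-- An embedding is injective on paths (§0: a path is its list of arrows). [cite: MochizukiAbsTopIII2015, Section 0 p.26] -/
theorem GraphEmbedding.mapPath_injective {F : V' ⥤q V} (hF : GraphEmbedding F) {a : V'} :
    ∀ {b : V'} (p q : Path a b), F.mapPath p = F.mapPath q → p = q
  | _, Path.nil, q, h => by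
    cases q with
    | nil => rfl
    | cons q e =>
      have hl := congrArg Path.length h
      simp [Prefunctor.mapPath_cons, Path.length_cons] at hl
  | _, Path.cons p e, q, h => by
    cases q with
    | nil =>
      have hl := congrArg Path.length h
      simp [Prefunctor.mapPath_cons, Path.length_cons] at hl
    | cons q e' =>
      rw [Prefunctor.mapPath_cons, Prefunctor.mapPath_cons] at h
      obtain ⟨hcc, hpq, hee⟩ := Path.cons.inj h
      cases hF.obj_injective hcc
      cases hF.map_injective (eq_of_heq hee)
      rw [GraphEmbedding.mapPath_injective hF p q (eq_of_heq hpq)]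

/-- An embedding is injective on paths with a priori different endpoints (heterogeneous form).
[cite: MochizukiAbsTopIII2015, Section 0 p.26] -/
theorem GraphEmbedding.eq_of_mapPath_heq {F : V' ⥤q V} (hF : GraphEmbedding F) {a a' b b' : V'} (p : Path a b)
    (p' : Path a' b') (ha : F.obj a = F.obj a') (hb : F.obj b = F.obj b') (h : HEq (F.mapPath p) (F.mapPath p')) :
    a = a' ∧ b = b' ∧ HEq p p' := by
  cases hF.obj_injective ha
  cases hF.obj_injective hb
  exact ⟨rfl, rfl, heq_of_eq (hF.mapPath_injective p p' (eq_of_heq h))⟩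

/-- `F : Γ⃗' → Γ⃗` is a **sieve**: every arrow of `Γ⃗` INTO a vertex of `Γ⃗'` is (the image of) an arrow of `Γ⃗'` — the shape of the
sub-diagrams `𝒟_{≤n}`, `D•_{≤2} ∪ {𝒩⊞_v}` of [AbsTopIII] (nothing enters the first rows from below).
[cite: MochizukiAbsTopIII2015, Section 0 p.26] -/
def IsSieve (F : V' ⥤q V) : Prop :=
  ∀ ⦃c : V⦄ ⦃b' : V'⦄ (e : c ⟶ F.obj b'), ∃ (c' : V') (e' : c' ⟶ b'), F.obj c' = c ∧ HEq (F.map e') e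

/-- Along a sieve every path of `Γ⃗` into a vertex of `Γ⃗'` lifts to `Γ⃗'`. [cite: MochizukiAbsTopIII2015, Section 0 p.26] -/
theorem IsSieve.exists_mapPath {F : V' ⥤q V} (hS : IsSieve F) {c b : V} (r : Path c b) :
    ∀ {b' : V'}, b = F.obj b' → ∃ (c' : V') (r' : Path c' b'), F.obj c' = c ∧ HEq (F.mapPath r') r := by
  induction r with
  | nil => intro b' hb; exact ⟨b', Path.nil, hb.symm, by subst hb; rfl⟩
  | cons r e ih =>
    intro b' hb
    subst hb
    obtain ⟨d', e', hd, he⟩ := hS e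
    subst hd
    obtain ⟨c', r', hc, hr⟩ := ih rfl
    subst hc
    cases hr
    cases he
    exact ⟨c', r'.cons e', rfl, HEq.rfl⟩

/-! ## Pairs of paths of `𝒟` lifting to boundary pairs of a family on `F^*𝒟` -/

/-- `eqToHom` bookkeeping: a morphism conjugated twice by `eqToHom`s is conjugated once (whatever the presentations of the
intermediate objects). [folklore] -/
private theorem eqToHom_conj_conj_eq {C : Type*} [Category C] {a₁ a₂ a₃ b₁ b₂ b₃ : C} (f : a₃ ⟶ b₃) (h₁ : a₁ = a₂)
    (h₂ : a₂ = a₃) (h₃ : b₃ = b₂) (h₄ : b₂ = b₁) (h₅ : a₁ = a₃) (h₆ : b₃ = b₁) :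
    eqToHom h₁ ≫ (eqToHom h₂ ≫ f ≫ eqToHom h₃) ≫ eqToHom h₄ = eqToHom h₅ ≫ f ≫ eqToHom h₆ := by
  subst h₁ h₂ h₃ h₄
  simp

section Lift

variable (D : DiagramOfCategories.{v, u, w} V) (ω : V') (K : (D.comapAlong F).HomotopyFamily)

/-- Transport of a homotopy along an identification of its pair of paths with a pair of paths out of another (equal) vertex
(bookkeeping). [cite: MochizukiAbsTopIII2015, Definition 3.5 (ii) p.75] -/
noncomputable def transportHom {a₁ a₂ b : V} (ha : a₁ = a₂) {p₁ q₁ : Path a₁ b} {p₂ q₂ : Path a₂ b} (hp : HEq p₁ p₂)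
    (hq : HEq q₁ q₂) (θ : D.pathFunctor p₁ ⟶ D.pathFunctor q₁) : D.pathFunctor p₂ ⟶ D.pathFunctor q₂ := by
  subst ha
  exact eqToHom (by rw [eq_of_heq hp]) ≫ θ ≫ eqToHom (by rw [eq_of_heq hq])

/-- Transport along the trivial identification. [cite: MochizukiAbsTopIII2015, Definition 3.5 (ii) p.75] -/
theorem transportHom_rfl {a b : V} {p q : Path a b} (θ : D.pathFunctor p ⟶ D.pathFunctor q) :
    D.transportHom rfl (HEq.refl p) (HEq.refl q) θ = θ := by
  simp [transportHom]

/-- Transport along equalities of paths out of the same vertex is conjugation by `eqToHom`s.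
[cite: MochizukiAbsTopIII2015, Definition 3.5 (ii) p.75] -/
theorem transportHom_eq {a b : V} {p₁ p₂ q₁ q₂ : Path a b} (hp : p₁ = p₂) (hq : q₁ = q₂)
    (θ : D.pathFunctor p₁ ⟶ D.pathFunctor q₁) :
    D.transportHom rfl (heq_of_eq hp) (heq_of_eq hq) θ = eqToHom (by rw [hp]) ≫ θ ≫ eqToHom (by rw [hq]) := by
  subst hp hq
  simp [transportHom]

/-- **A lifting pair**: a co-verticial pair `(γ₁, γ₂)` of paths of `𝒟` into `F ω` that is the image of a boundary pair of `K` into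
`ω` (Def. 3.5 (ii)/(iii): the family of the sub-diagram read inside `𝒟`). [cite: MochizukiAbsTopIII2015, Definition 3.5 (iii) p.75] -/
structure LiftPair {a : V} (p q : Path a (F.obj ω)) : Type (max u v w w') where
  /-- the common source in `Γ⃗'` -/
  src : V'
  /-- the lifted left path -/
  left : Path src ω
  /-- the lifted right path -/
  right : Path src ω
  mem : K.E left right
  src_eq : F.obj src = a
  left_heq : HEq (F.mapPath left) p
  right_heq : HEq (F.mapPath right) q

namespace LiftPair

variable {F D ω K}

/-- The homotopy of a lifting pair: the homotopy of `K`, read on the path functors of `𝒟` (`(F^*𝒟)_[γ] = 𝒟_[F γ]`,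
abc-iut-L4-t5's `pathFunctor_comapAlong`). [cite: MochizukiAbsTopIII2015, Definition 3.5 (ii) p.75] -/
noncomputable def hom {a : V} {p q : Path a (F.obj ω)} (w : LiftPair F D ω K p q) : D.pathFunctor p ⟶ D.pathFunctor q :=
  D.transportHom w.src_eq w.left_heq w.right_heq
    (eqToHom (D.pathFunctor_comapAlong F w.left).symm ≫ K.η w.mem ≫ eqToHom (D.pathFunctor_comapAlong F w.right))

/-- A boundary pair of `K` gives a lifting pair of its image. [cite: MochizukiAbsTopIII2015, Definition 3.5 (iii) p.75] -/
def ofMem {src : V'} {left right : Path src ω} (mem : K.E left right) : LiftPair F D ω K (F.mapPath left) (F.mapPath right) :=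
  ⟨src, left, right, mem, rfl, HEq.rfl, HEq.rfl⟩

/-- Its homotopy is the homotopy of `K` (re-typed). [cite: MochizukiAbsTopIII2015, Definition 3.5 (ii) p.75] -/
theorem hom_ofMem {src : V'} {left right : Path src ω} (mem : K.E left right) :
    (ofMem (F := F) (D := D) mem).hom =
      eqToHom (D.pathFunctor_comapAlong F left).symm ≫ K.η mem ≫ eqToHom (D.pathFunctor_comapAlong F right) :=
  D.transportHom_rfl _

/-- **Lifting pairs are unique** when `F` is an embedding (so their homotopy depends on the pair only).
[cite: MochizukiAbsTopIII2015, Section 0 p.26] -/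
theorem subsingleton' (hF : GraphEmbedding F) {a : V} {p q : Path a (F.obj ω)} (w w' : LiftPair F D ω K p q) : w = w' := by
  obtain ⟨src, left, right, mem, hs, hl, hr⟩ := w
  obtain ⟨src', left', right', mem', hs', hl', hr'⟩ := w'
  obtain ⟨rfl, -, hll⟩ := hF.eq_of_mapPath_heq left left' (hs.trans hs'.symm) rfl (hl.trans hl'.symm)
  cases hll
  obtain ⟨-, -, hrr⟩ := hF.eq_of_mapPath_heq right right' rfl rfl (hr.trans hr'.symm)
  cases hrr
  rfl

end LiftPair

/-- The member pairs of the sink pre-family at `F ω`: pairs admitting a lifting pair. [cite: MochizukiAbsTopIII2015, Definition 3.5 (iii) p.75] -/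
def liftE ⦃a : V⦄ (p q : Path a (F.obj ω)) : Prop := Nonempty (LiftPair F D ω K p q)

/-- Their homotopies. [cite: MochizukiAbsTopIII2015, Definition 3.5 (ii) p.75] -/
noncomputable def liftη ⦃a : V⦄ ⦃p q : Path a (F.obj ω)⦄ (h : liftE F D ω K p q) : D.pathFunctor p ⟶ D.pathFunctor q :=
  (Classical.choice h).hom

variable {F D ω K}

/-- The homotopy is computed by ANY lifting pair (embedding). [cite: MochizukiAbsTopIII2015, Definition 3.5 (ii) p.75] -/
theorem liftη_eq (hF : GraphEmbedding F) {a : V} {p q : Path a (F.obj ω)} (h : liftE F D ω K p q)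
    (w : LiftPair F D ω K p q) : liftη F D ω K h = w.hom := by
  rw [liftη, LiftPair.subsingleton' hF (Classical.choice h) w]

/-- A boundary pair of `K` is a member with the homotopy of `K`. [cite: MochizukiAbsTopIII2015, Definition 3.5 (ii) p.75] -/
theorem liftη_ofMem (hF : GraphEmbedding F) {src : V'} {left right : Path src ω} (mem : K.E left right) :
    ∃ h : liftE F D ω K (F.mapPath left) (F.mapPath right),
      liftη F D ω K h = eqToHom (D.pathFunctor_comapAlong F left).symm ≫ K.η mem ≫
        eqToHom (D.pathFunctor_comapAlong F right) :=
  ⟨⟨LiftPair.ofMem mem⟩, (liftη_eq hF _ (LiftPair.ofMem mem)).trans (LiftPair.hom_ofMem mem)⟩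

/-- **Identity on diagonal members** (Def. 3.5 (ii): `ζ_{([γ],[γ])} = id`). [cite: MochizukiAbsTopIII2015, Definition 3.5 (ii) p.75] -/
theorem liftη_self (hF : GraphEmbedding F) {a : V} {p : Path a (F.obj ω)} (h : liftE F D ω K p p) :
    liftη F D ω K h = 𝟙 _ := by
  obtain ⟨w⟩ := h
  rw [liftη_eq hF _ w]
  obtain ⟨src, left, right, mem, hs, hl, hr⟩ := w
  subst hs
  obtain ⟨-, -, hlr⟩ := hF.eq_of_mapPath_heq left right rfl rfl (hl.trans hr.symm)
  cases hlr
  cases hl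
  change (LiftPair.ofMem (F := F) (D := D) mem).hom = 𝟙 _
  rw [LiftPair.hom_ofMem, K.η_refl mem]
  simp

/-- **Composition of members** (Def. 3.5 (ii): `ζ_{ϖ''} = ζ_{ϖ'} ∘ ζ_ϖ`). [cite: MochizukiAbsTopIII2015, Definition 3.5 (ii) p.75] -/
theorem lift_trans (hF : GraphEmbedding F) {a : V} {p q r : Path a (F.obj ω)} (h₁ : liftE F D ω K p q)
    (h₂ : liftE F D ω K q r) : ∃ h₃ : liftE F D ω K p r, liftη F D ω K h₃ = liftη F D ω K h₁ ≫ liftη F D ω K h₂ := by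
  obtain ⟨w₁⟩ := h₁
  obtain ⟨w₂⟩ := h₂
  rw [liftη_eq hF _ w₁, liftη_eq hF _ w₂]
  obtain ⟨src, left, mid, mem₁, hs, hl, hm⟩ := w₁
  obtain ⟨src', mid', right, mem₂, hs', hm', hr⟩ := w₂
  subst hs
  obtain ⟨rfl, -, hmm⟩ := hF.eq_of_mapPath_heq mid' mid hs' rfl (hm'.trans hm.symm)
  cases hmm
  cases hl; cases hm; cases hr
  change ∃ h₃ : liftE F D ω K _ _,
    liftη F D ω K h₃ = (LiftPair.ofMem (F := F) (D := D) mem₁).hom ≫ (LiftPair.ofMem (F := F) (D := D) mem₂).hom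
  refine ⟨⟨LiftPair.ofMem (K.isSaturated.trans mem₁ mem₂)⟩, ?_⟩
  rw [liftη_eq hF _ (LiftPair.ofMem (K.isSaturated.trans mem₁ mem₂)), LiftPair.hom_ofMem, LiftPair.hom_ofMem,
    LiftPair.hom_ofMem, K.η_trans mem₁ mem₂]
  simp

/-- **Pre-whiskering of members** along a sieve (Def. 3.5 (ii), third axiom with trivial suffix): a member pair at `F ω`
pre-composed with ANY path of `𝒟` is a member pair (the path lifts), with the pre-whiskered homotopy, componentwise.
[cite: MochizukiAbsTopIII2015, Definition 3.5 (ii) p.75] -/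
theorem lift_precomp (hF : GraphEmbedding F) (hS : IsSieve F) {c a : V} {p q : Path a (F.obj ω)}
    (h : liftE F D ω K p q) (r : Path c a) :
    ∃ h' : liftE F D ω K (r.comp p) (r.comp q), ∀ x : D.obj c,
      (liftη F D ω K h').app x = eqToHom (D.pathFunctor_comp_obj r p x) ≫
        (liftη F D ω K h).app ((D.pathFunctor r).obj x) ≫ eqToHom (D.pathFunctor_comp_obj r q x).symm := by
  obtain ⟨w⟩ := h
  obtain ⟨src, left, right, mem, hs, hl, hq⟩ := w
  subst hs
  cases hl; cases hq
  obtain ⟨c', r', hc, hr⟩ := hS.exists_mapPath r rfl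
  subst hc
  cases hr
  -- the lifted member: `(r' ∘ left, r' ∘ right)`, a boundary pair of `K` by pre-composition
  have mem' : K.E (r'.comp left) (r'.comp right) := K.isSaturated.precomp (K.isSaturated.postcomp mem Path.nil) r'
  have hp : F.mapPath (r'.comp left) = (F.mapPath r').comp (F.mapPath left) := Prefunctor.mapPath_comp F r' left
  have hq : F.mapPath (r'.comp right) = (F.mapPath r').comp (F.mapPath right) := Prefunctor.mapPath_comp F r' right
  let w' : LiftPair F D ω K ((F.mapPath r').comp (F.mapPath left)) ((F.mapPath r').comp (F.mapPath right)) :=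
    ⟨c', r'.comp left, r'.comp right, mem', rfl, heq_of_eq hp, heq_of_eq hq⟩
  refine ⟨⟨w'⟩, fun x => ?_⟩
  rw [liftη_eq hF _ w', liftη_eq hF _ (LiftPair.ofMem mem), LiftPair.hom_ofMem]
  -- `w'.hom` is the homotopy of `K` at the lifted member re-indexed along the path equations `hp`, `hq`
  have hw' : w'.hom = eqToHom _ ≫ (eqToHom (D.pathFunctor_comapAlong F (r'.comp left)).symm ≫ K.η mem' ≫
      eqToHom (D.pathFunctor_comapAlong F (r'.comp right))) ≫ eqToHom _ :=
    D.transportHom_eq hp hq _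
  -- the whiskering axiom of `K` (pre-composition by `r'`, trivial post-composition)
  have hw : K.η (p := r'.comp left) (q := r'.comp right) mem' = _ := K.η_whisker mem r' Path.nil
  rw [hw', hw]
  dsimp only [Path.comp_nil]
  simp only [NatTrans.comp_app, eqToHom_app, Category.assoc, Functor.whiskerLeft_app, Functor.whiskerRight_app]
  rw [pathFunctor_nil_map, OverData.app_congr_obj (K.η mem) (Functor.congr_obj (D.pathFunctor_comapAlong F r') x)]
  simp only [Category.assoc, eqToHom_trans, eqToHom_trans_assoc]
  exact eqToHom_conj_conj_eq _ _ _ _ _ _ _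

end Lift

end DiagramOfCategories

end Literature.AnabelianGeometry.AbsoluteAnabelian
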